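import Summits.ResolutionOfSingularities.ResolutionOfSingularities.Theorems.FrobeniusLadderFInjectiveMacaulayficationFedderCriterion
import Summits.ResolutionOfSingularities.ResolutionOfSingularities.Theorems.FrobeniusLadderFInjectiveMacaulayficationCIFedderAtMaximalIdeal
import Summits.ResolutionOfSingularities.ResolutionOfSingularities.Theorems.FrobeniusLadderFInjectiveMacaulayficationDegreeZeroDescentLocal
import Literature.AlgebraicGeometry.Resolution.WeakJacobianPolynomial
import Mathlib.AlgebraicGeometry.Spec
import Mathlib.RingTheory.MvPolynomial.Ideal
import Summits.ResolutionOfSingularities.ResolutionOfSingularities.Theorems.FrobeniusLadderFInjectiveMacaulayficationQ6Prime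
import HarnessLib

/-!
# CN data × 𝔸¹ — THE AXIS POINT IS BAD: Fedder's test along the axis of a cylinder (crux `FInjectiveMacaulayfication`
# stmt-ResolutionOfSingularities-15315, chain w45a, hole #3; honesty companion of `…CNCylinder.lean` / Q6-LINE)

Support file for crux stmt-ResolutionOfSingularities-15315 (`FrobeniusLadder.FInjectiveMacaulayfication`), chain w45a, seat
res-D-pv-017 AS res-L1-w45a-stub-5. [OURS · L1 W4.5a] — NOT a statement of any manuscript; AI-written, weaker than expert review.

`strongPlusStep_cylinder_of_cnData` produces the ∃-clause of the hole-#3 stub `stub_confinedIsoStepStrongPlus` at the generic point `η`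
of the axis of `Spec k[X_{n+1}]/(rename succ f)`. The stub's ANTECEDENT there is that `η` is a BAD non-closed point. This file certifies
the badness whenever FEDDER'S ELEMENT VANISHES TO ORDER `p`: if `f^(p−1) ∈ (X₀^p, …, X_{n−1}^p)` in `k[X_n]` (e.g. `ord₀ f > n`, by
pigeonhole), then the per-stalk clause FAILS at `η`:
* `algebraMap_pow_mem_frobeniusPower_of_mem_span` — ring level: `g^(p−1) ∈ (a^p : a ∈ T)`, `T ⊆ P` ⇒ the image of `g^(p−1)` lies in
  the Frobenius power of the maximal ideal of `k[X]_P` (Fedder's test fails);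
* `cylinder_axis_stalk_not_clause` — scheme level: the stalk of `Spec k[X_{n+1}]/(f′)` at `η` violates the clause (transport along
  `Spec.stalkIso` and `CIFedderAtMaximalIdeal.nonempty_quotLocalizationEquiv`);
First consumer: Q6-LINE (`f₂` of order `6 > 3` at the origin, `p = 5`: `f₂⁴ ∈ (X₀⁵,X₁⁵,X₂⁵)`). No definitions, no named facts.
[cite: Fedder1983, Prop. 1.7 and Thm. 1.12]
-/

-- single-problem summit: the doubled namespace component is forced
set_option linter.dupNamespace false

noncomputable section

open AlgebraicGeometry MvPolynomial IsLocalRing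
open Literature.RingTheory.TightClosure

namespace Summit.ResolutionOfSingularities.ResolutionOfSingularities.Theorems.FInjectiveMacaulayfication.CNCylinder

open Summit.ResolutionOfSingularities.ResolutionOfSingularities.Theorems.FInjectiveMacaulayfication

/-! ## §1 Ring level: Fedder's element at an arbitrary prime of `k[X]` -/

/-- If `g^(p−1)` lies in the ideal generated by the `p`-th powers of elements of a prime `P` of `k[X_m]`, then its image lies in the
Frobenius power `𝔪^[p]` of the maximal ideal of the regular local ring `k[X_m]_P` (so Fedder's test FAILS for `k[X_m]_P/(g)`).
[cite: Fedder1983, Prop. 1.7] -/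
theorem algebraMap_pow_mem_frobeniusPower_of_mem_span (p : ℕ) (k : Type) [Field k] {m : ℕ}
    (P : Ideal (MvPolynomial (Fin m) k)) [P.IsPrime] (g : MvPolynomial (Fin m) k)
    (T : Set (MvPolynomial (Fin m) k)) (hT : T ⊆ P) (hfed : g ^ (p - 1) ∈ Ideal.span ((fun a => a ^ p) '' T)) :
    (algebraMap (MvPolynomial (Fin m) k) (Localization.AtPrime P) g) ^ (p - 1) ∈
      frobeniusPower p (maximalIdeal (Localization.AtPrime P)) := by
  rw [← map_pow]
  have hle : (Ideal.span ((fun a => a ^ p) '' T)).map (algebraMap (MvPolynomial (Fin m) k) (Localization.AtPrime P)) ≤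
      frobeniusPower p (maximalIdeal (Localization.AtPrime P)) := by
    rw [Ideal.map_span, Ideal.span_le]
    rintro _ ⟨_, ⟨a, ha, rfl⟩, rfl⟩
    rw [SetLike.mem_coe, map_pow]
    refine pow_mem_frobeniusPower ?_
    rw [← IsLocalization.AtPrime.map_eq_maximalIdeal P (Localization.AtPrime P)]
    exact Ideal.mem_map_of_mem _ (hT ha)
  exact hle (Ideal.mem_map_of_mem _ hfed)

/-! ## §2 Scheme level: the stalk of the cylinder at the axis point -/

set_option maxHeartbeats 800000 in
/-- **THE AXIS POINT OF A CYLINDER IS BAD when `f^(p−1) ∈ (X₀^p,…,X_{n−1}^p)`**: for `f ≠ 0` in `k[X_n]` and the point `η` of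
`Spec k[X_{n+1}]/(rename succ f)` with `η.asIdeal = (x̄₁,…,x̄_n)`, the per-stalk clause of the crux FAILS at `η` (the antecedent
«`η` bad» of `stub_confinedIsoStepStrongPlus`): the stalk is `k[X_{n+1}]_P/(f′)`, `P = (X₁,…,X_n) ⊇ (f′)` the pull-back of `η`, a
hypersurface in a regular local ring, and Fedder's element `f′^(p−1)` lies in `P^[p]`. [cite: Fedder1983, Prop. 1.7 and Thm. 1.12] -/
theorem cylinder_axis_stalk_not_clause (p : ℕ) [Fact p.Prime] (k : Type) [Field k] [CharP k p] {n : ℕ}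
    (f : MvPolynomial (Fin n) k) (hf0 : f ≠ 0)
    (hfed : f ^ (p - 1) ∈ Ideal.span (Set.range fun i : Fin n => (X i : MvPolynomial (Fin n) k) ^ p))
    (η : ↥(Spec (.of (MvPolynomial (Fin (n + 1)) k ⧸ Ideal.span {rename Fin.succ f}))))
    (hη : η.asIdeal = Ideal.span (Set.range fun j : Fin n => Ideal.Quotient.mk (Ideal.span {rename Fin.succ f}) (X j.succ))) :
    ¬ (∀ d : ℕ, ringKrullDim ((Spec (.of (MvPolynomial (Fin (n + 1)) k ⧸ Ideal.span {rename Fin.succ f}))).presheaf.stalk η) = d →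
      ∀ s : Fin d → (Spec (.of (MvPolynomial (Fin (n + 1)) k ⧸ Ideal.span {rename Fin.succ f}))).presheaf.stalk η,
        (Ideal.span (Set.range s)).radical.IsMaximal →
          RingTheory.Sequence.IsWeaklyRegular
              ((Spec (.of (MvPolynomial (Fin (n + 1)) k ⧸ Ideal.span {rename Fin.succ f}))).presheaf.stalk η) (List.ofFn s) ∧
          ∀ t : (Spec (.of (MvPolynomial (Fin (n + 1)) k ⧸ Ideal.span {rename Fin.succ f}))).presheaf.stalk η,
            (∃ e : ℕ, t ^ p ^ e ∈ Ideal.span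
              ((fun z : (Spec (.of (MvPolynomial (Fin (n + 1)) k ⧸ Ideal.span {rename Fin.succ f}))).presheaf.stalk η => z ^ p ^ e) ''
                (Ideal.span (Set.range s) :
                  Set ((Spec (.of (MvPolynomial (Fin (n + 1)) k ⧸ Ideal.span {rename Fin.succ f}))).presheaf.stalk η)))) →
              t ∈ Ideal.span (Set.range s)) := by
  intro hcl
  -- the prime `P ⊇ (f′)` of `k[X_{n+1}]` under `η`, and the regular local ring `k[X]_P`
  haveI hPp : (η.asIdeal.comap (Ideal.Quotient.mk (Ideal.span {rename Fin.succ f}))).IsPrime := Ideal.comap_isPrime _ _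
  haveI : IsRegularLocalRing (Localization.AtPrime (η.asIdeal.comap (Ideal.Quotient.mk (Ideal.span {rename Fin.succ f})))) :=
    IsRegularRing.isRegularLocalRing_localization _
  have hinj : Function.Injective (algebraMap (MvPolynomial (Fin (n + 1)) k) (Localization.AtPrime (η.asIdeal.comap (Ideal.Quotient.mk (Ideal.span {rename Fin.succ f}))))) :=
    IsLocalization.injective _ (η.asIdeal.comap (Ideal.Quotient.mk (Ideal.span {rename Fin.succ f}))).primeCompl_le_nonZeroDivisors
  haveI : CharP (Localization.AtPrime (η.asIdeal.comap (Ideal.Quotient.mk (Ideal.span {rename Fin.succ f})))) p :=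
    charP_of_injective_algebraMap hinj p
  have hf'P : (rename Fin.succ f : MvPolynomial (Fin (n + 1)) k) ∈ η.asIdeal.comap (Ideal.Quotient.mk (Ideal.span {rename Fin.succ f})) := by
    rw [Ideal.mem_comap, Ideal.Quotient.eq_zero_iff_mem.mpr (Ideal.mem_span_singleton_self _)]
    exact η.asIdeal.zero_mem
  have hXP : ∀ j : Fin n, (X j.succ : MvPolynomial (Fin (n + 1)) k) ∈ η.asIdeal.comap (Ideal.Quotient.mk (Ideal.span {rename Fin.succ f})) := by
    intro j
    rw [Ideal.mem_comap, hη]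
    exact Ideal.subset_span ⟨j, rfl⟩
  have hf'0 : (rename Fin.succ f : MvPolynomial (Fin (n + 1)) k) ≠ 0 := fun h => hf0 (rename_injective _ (Fin.succ_injective n) (by rw [h, map_zero]))
  have hgm : algebraMap (MvPolynomial (Fin (n + 1)) k) (Localization.AtPrime (η.asIdeal.comap (Ideal.Quotient.mk (Ideal.span {rename Fin.succ f}))))
      (rename Fin.succ f) ∈ maximalIdeal _ := by
    rw [← IsLocalization.AtPrime.map_eq_maximalIdeal (η.asIdeal.comap (Ideal.Quotient.mk (Ideal.span {rename Fin.succ f}))) (Localization.AtPrime _)]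
    exact Ideal.mem_map_of_mem _ hf'P
  have hg0 : algebraMap (MvPolynomial (Fin (n + 1)) k) (Localization.AtPrime (η.asIdeal.comap (Ideal.Quotient.mk (Ideal.span {rename Fin.succ f}))))
      (rename Fin.succ f) ≠ 0 := fun h => hf'0 (hinj (by rw [h, map_zero]))
  -- Fedder's element of the cylinder: `(rename f)^(p-1) ∈ (X_{succ i}^p)`
  have hfed' : (rename Fin.succ f : MvPolynomial (Fin (n + 1)) k) ^ (p - 1) ∈ Ideal.span ((fun a : MvPolynomial (Fin (n + 1)) k => a ^ p) '' Set.range fun j : Fin n => (X j.succ : MvPolynomial (Fin (n + 1)) k)) := by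
    have h := Ideal.mem_map_of_mem (rename Fin.succ : MvPolynomial (Fin n) k →ₐ[k] MvPolynomial (Fin (n + 1)) k).toRingHom hfed
    rw [map_pow, Ideal.map_span] at h
    refine (Ideal.span_mono ?_) h
    rintro _ ⟨_, ⟨i, rfl⟩, rfl⟩
    exact ⟨X i.succ, ⟨i, rfl⟩, by simp [rename_X]⟩
  have hfrob := algebraMap_pow_mem_frobeniusPower_of_mem_span p k (η.asIdeal.comap (Ideal.Quotient.mk (Ideal.span {rename Fin.succ f})))
    (rename Fin.succ f) _ (by rintro _ ⟨j, rfl⟩; exact hXP j) hfed'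
  -- transport the clause from the stalk at `η` to `k[X]_P/(f′)` and apply Fedder
  obtain ⟨e₁⟩ := CIFedderAtMaximalIdeal.nonempty_quotLocalizationEquiv (MvPolynomial (Fin (n + 1)) k) (Ideal.span {rename Fin.succ f}) η.asIdeal
  have hIJ : (Ideal.span {(rename Fin.succ f : MvPolynomial (Fin (n + 1)) k)}).map (algebraMap (MvPolynomial (Fin (n + 1)) k)
      (Localization.AtPrime (η.asIdeal.comap (Ideal.Quotient.mk (Ideal.span {rename Fin.succ f}))))) =
      Ideal.span {algebraMap (MvPolynomial (Fin (n + 1)) k) (Localization.AtPrime (η.asIdeal.comap (Ideal.Quotient.mk (Ideal.span {rename Fin.succ f})))) (rename Fin.succ f)} := by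
    rw [Ideal.map_span, Set.image_singleton]
  have e₀ := (Spec.stalkIso (.of (MvPolynomial (Fin (n + 1)) k ⧸ Ideal.span {(rename Fin.succ f : MvPolynomial (Fin (n + 1)) k)})) η).commRingCatIsoToRingEquiv
  have hcl' := DegreeZeroDescent.inlineClause_of_ringEquiv p ((e₀.trans e₁.symm).trans (Ideal.quotEquivOfEq hIJ)) hcl
  exact (Fedder.fedder_hypersurface_clause_iff p hgm hg0).mp hcl' hfrob

/-! ## §3 Fedder's element by pigeonhole, and the Q6 cylinder -/

/-- **Pigeonhole**: in `k[X_m]`, a polynomial all of whose monomials have degree `> m·(p−1)` lies in `(X₀^p, …, X_{m−1}^p)`. [folklore] -/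
theorem mem_span_X_pow_of_mem_pow_idealOfVars {k : Type} [Field k] {m : ℕ} (p N : ℕ) (hN : m * (p - 1) < N)
    (x : MvPolynomial (Fin m) k) (hx : x ∈ idealOfVars (Fin m) k ^ N) :
    x ∈ Ideal.span (Set.range fun i : Fin m => (X i : MvPolynomial (Fin m) k) ^ p) := by
  classical
  rw [mem_pow_idealOfVars_iff] at hx
  have hS : (Set.range fun i : Fin m => (X i : MvPolynomial (Fin m) k) ^ p) =
      (fun s : Fin m →₀ ℕ => monomial s (1 : k)) '' Set.range (fun i : Fin m => Finsupp.single i p) := by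
    rw [← Set.range_comp]
    congr 1
    funext i
    simp [X_pow_eq_monomial]
  rw [hS, mem_ideal_span_monomial_image]
  intro mo hmo
  have hdeg := hx mo hmo
  -- some exponent is `≥ p`
  by_contra hcon
  push Not at hcon
  have hall : ∀ i : Fin m, mo i ≤ p - 1 := fun i => by
    have h := hcon (Finsupp.single i p) ⟨i, rfl⟩
    rw [Finsupp.single_le_iff] at h
    omega
  have hsum : Finsupp.degree mo ≤ m * (p - 1) := by
    rw [Finsupp.degree_eq_sum]
    calc ∑ i : Fin m, mo i ≤ ∑ _i : Fin m, (p - 1) := Finset.sum_le_sum fun i _ => hall i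
      _ = m * (p - 1) := by simp
  omega

set_option maxRecDepth 8192 in
/-- **The axis point of the Q6 cylinder is BAD** (char 5): `f₂ ∈ 𝔪⁶`, so `f₂⁴ ∈ 𝔪²⁴ ⊆ (X₀⁵,X₁⁵,X₂⁵)` (`3·4 < 24`), and
`cylinder_axis_stalk_not_clause` applies — the per-stalk clause FAILS at every `η` with `η.asIdeal = (x̄₁,x̄₂,x̄₃)`. Together with
`Q6LineStrongPlusStep.q6Line_strongPlusStep` this makes Q6-LINE an instance of `stub_confinedIsoStepStrongPlus` with a TRUE badness
antecedent. [cite: Fedder1983, Prop. 1.7 and Thm. 1.12] -/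
theorem q6Line_axis_stalk_not_clause (k : Type) [Field k] [CharP k 5] (f : MvPolynomial (Fin 3) k)
    (hf : f = MvPolynomial.X 0 ^ 3 * MvPolynomial.X 1 ^ 3 + MvPolynomial.X 0 ^ 3 * MvPolynomial.X 2 ^ 3 +
        MvPolynomial.X 1 ^ 3 * MvPolynomial.X 2 ^ 3 + MvPolynomial.X 2 ^ 6 + MvPolynomial.X 0 ^ 8 + MvPolynomial.X 1 ^ 8)
    (η : ↥(Spec (.of (MvPolynomial (Fin 4) k ⧸ Ideal.span {rename Fin.succ f}))))
    (hη : η.asIdeal = Ideal.span (Set.range fun j : Fin 3 => Ideal.Quotient.mk (Ideal.span {rename Fin.succ f}) (X j.succ))) :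
    ¬ (∀ d : ℕ, ringKrullDim ((Spec (.of (MvPolynomial (Fin 4) k ⧸ Ideal.span {rename Fin.succ f}))).presheaf.stalk η) = d →
      ∀ s : Fin d → (Spec (.of (MvPolynomial (Fin 4) k ⧸ Ideal.span {rename Fin.succ f}))).presheaf.stalk η,
        (Ideal.span (Set.range s)).radical.IsMaximal →
          RingTheory.Sequence.IsWeaklyRegular
              ((Spec (.of (MvPolynomial (Fin 4) k ⧸ Ideal.span {rename Fin.succ f}))).presheaf.stalk η) (List.ofFn s) ∧
          ∀ t : (Spec (.of (MvPolynomial (Fin 4) k ⧸ Ideal.span {rename Fin.succ f}))).presheaf.stalk η,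
            (∃ e : ℕ, t ^ 5 ^ e ∈ Ideal.span
              ((fun z : (Spec (.of (MvPolynomial (Fin 4) k ⧸ Ideal.span {rename Fin.succ f}))).presheaf.stalk η => z ^ 5 ^ e) ''
                (Ideal.span (Set.range s) :
                  Set ((Spec (.of (MvPolynomial (Fin 4) k ⧸ Ideal.span {rename Fin.succ f}))).presheaf.stalk η)))) →
              t ∈ Ideal.span (Set.range s)) := by
  haveI : Fact (Nat.Prime 5) := ⟨by norm_num⟩
  -- `f₂ ∈ 𝔪⁶`, hence `f₂⁴ ∈ 𝔪²⁴ ⊆ (Xᵢ⁵)`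
  have hX : ∀ i : Fin 3, (X i : MvPolynomial (Fin 3) k) ∈ idealOfVars (Fin 3) k := fun i => Ideal.subset_span ⟨i, rfl⟩
  have hmon : ∀ (i j : Fin 3) (a b : ℕ), (X i : MvPolynomial (Fin 3) k) ^ a * X j ^ b ∈ idealOfVars (Fin 3) k ^ (a + b) :=
    fun i j a b => by rw [pow_add]; exact Ideal.mul_mem_mul (Ideal.pow_mem_pow (hX i) a) (Ideal.pow_mem_pow (hX j) b)
  have hle8 : idealOfVars (Fin 3) k ^ 8 ≤ idealOfVars (Fin 3) k ^ 6 := Ideal.pow_le_pow_right (by norm_num)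
  have hf6 : f ∈ idealOfVars (Fin 3) k ^ 6 := by
    rw [hf]
    refine Ideal.add_mem _ (Ideal.add_mem _ (Ideal.add_mem _ (Ideal.add_mem _ (Ideal.add_mem _ ?_ ?_) ?_) ?_) ?_) ?_
    · exact hmon 0 1 3 3
    · exact hmon 0 2 3 3
    · exact hmon 1 2 3 3
    · simpa using Ideal.pow_mem_pow (hX 2) 6
    · exact hle8 (by simpa using Ideal.pow_mem_pow (hX 0) 8)
    · exact hle8 (by simpa using Ideal.pow_mem_pow (hX 1) 8)
  have hf24 : f ^ (5 - 1) ∈ idealOfVars (Fin 3) k ^ 24 := by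
    rw [show (5 - 1 : ℕ) = 4 from rfl, show (24 : ℕ) = 6 * 4 from rfl, pow_mul]
    exact Ideal.pow_mem_pow hf6 4
  have h324 : 3 * (5 - 1) < 24 := by decide
  have hfed : f ^ (5 - 1) ∈ Ideal.span (Set.range fun i : Fin 3 => (X i : MvPolynomial (Fin 3) k) ^ 5) :=
    mem_span_X_pow_of_mem_pow_idealOfVars 5 24 h324 (f ^ (5 - 1)) hf24
  exact cylinder_axis_stalk_not_clause 5 k f (Q6Prime.q6_ne_zero f hf) hfed η hη

end Summit.ResolutionOfSingularities.ResolutionOfSingularities.Theorems.FInjectiveMacaulayfication.CNCylinder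

end
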